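/-
Copyright (c) 2026 the pub-hodgecm-mathlib formalisation cell (harness21).  Prover seat hodgecm-mathlib-K2Liu-p11 (g2), Track B «K2-LIT»,
#184♮ = hLiu418 = `stmt-HodgeConjecture-24832`; organ S2, σ8 S2-⊗ VALUE HALF (⊗-3)(⊗-4), generic skeleton (V-gen) (my census 13:11Z; LEAD BATCH #14 (2) ∕ #17, σ15).
THEOREMS ONLY (no `def`, no `instance`, no notation, no named-fact hypothesis, no `sorry`).
-/
import Mathlib.Algebra.Module.LinearMap.End
import Mathlib.Algebra.Group.Pi.Lemmas
import Mathlib.Algebra.BigOperators.Pi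
import Mathlib.Data.Complex.Basic
import HarnessLib

/-!
# Crux `HLiu418`, S2-⊗ VALUE HALF, generic skeleton: A REPRESENTATION OF `Π i, G i` ACTING FACTORWISE ON PURE TENSORS, A FUNCTIONAL MULTIPLICATIVE ON PURE TENSORS
# ⇒ MATRIX COEFFICIENTS OF PURE TENSORS ARE PRODUCTS OF ONE-FACTOR COEFFICIENTS, AND EVERY FINITE SUM OF SUCH PRODUCTS IS ONE MATRIX COEFFICIENT

Cell `hodgecm-mathlib`, crux item hLiu418 = `stmt-HodgeConjecture-24832` (helper lane `--supports`, count-neutral).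

GENERIC (instance = K2Liu-p05's J2c at each real place σ: `T` = the big Schwartz space, `τ` = iterated `⊠` along ★ `placeSplitEquiv`, `ρ` = the arch Weil action,
`op i` = `weilRepPair (·,1)` at the place, `ev` ∕ `evi` = the SW-value functionals; ★ `exists_circle_twist_factorisation_placeSec(J)` discharges BINDER (T) below).
SETTING: a finite index type `ι`, monoids `G i`, «one-factor spaces» `S i`, a «big space» `T` (a `ℂ`-module), a «pure tensor» map `τ : (Π i, S i) → T` (no multilinearity
needed), a representation `ρ : (Π i, G i) →* Module.End ℂ T`, one-factor actions `op i : G i → S i → S i`.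
BINDER (T) (factorwise action of the one-factor embeddings): `ρ (Pi.mulSingle i g) (τ Φ) = τ (update Φ i (op i g (Φ i)))`.
BINDER (E) (a functional multiplicative on pure tensors): `ev (τ Φ) = ∏ i, evi i (Φ i)`.
* §1 `restrict_insert` ∕ `restrict_univ` ∕ `restrict_empty` — the `s`-truncations `g|ₛ := fun i => if i ∈ s then g i else 1` and `g|_{insert a s} = ι_a(g a) · g|ₛ`;
* §2 **`rho_apply_tau`** — under (T): `ρ g (τ Φ) = τ (fun i => op i (g i) (Φ i))` (Finset induction on the truncations); **`ev_rho_apply_tau`** — under (T)(E):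
  `ev (ρ g (τ Φ)) = ∏ i, evi i (op i (g i) (Φ i))` ((⊗-3): the coefficient of a pure tensor is the product of the one-factor coefficients);
* §3 **`exists_vector_of_sum_prod`** — (⊗-4): if `A g = Σ_r c_r ∏_i b_{r,i}(g i)` (★ 2c-inst `exists_sum_prod_archPlaces`) and each `b_{r,i}` is a one-factor coefficient
  `b_{r,i} g = evi i (op i g (Ψ r i))` (S2-asm's per-place output), then `A g = ev (ρ g v)` for the ONE vector `v = Σ_r c_r • τ (Ψ r)` (`ev` linear).
References: [BorelJacquet1979, §4.1]; [Flath1979, §2]; [GanQiuTakeda2014, §5.6].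
HONEST LABEL: HC_CM is proved only modulo the 7 printed citations (2 remaining named inputs: hLiu418 = stmt-HodgeConjecture-24832,
h413 = stmt-HodgeConjecture-24833) until rung 0 closes; count-neutral helper, closes no socket.
-/

set_option autoImplicit false
set_option linter.dupNamespace false

namespace Summit.HodgeConjecture.HodgeConjecture.Cruxes.HLiu418.K2LiuPureTensorFactorwiseFunctional

variable {ι : Type*} [DecidableEq ι] {G : ι → Type*} [∀ i, Monoid (G i)]

/-! ## §1  Truncations of an element of `Π i, G i` to a finite set of coordinates -/

/-- `g|_∅ = 1`. [folklore] -/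
theorem restrict_empty (g : Π i, G i) : (fun i => if i ∈ (∅ : Finset ι) then g i else 1) = 1 := by
  funext i
  simp

/-- `g|_{univ} = g`. [folklore] -/
theorem restrict_univ [Fintype ι] (g : Π i, G i) : (fun i => if i ∈ (Finset.univ : Finset ι) then g i else 1) = g := by
  funext i
  simp

/-- `g|_{insert a s} = ι_a(g a) · g|ₛ` for `a ∉ s`. [folklore] -/
theorem restrict_insert (g : Π i, G i) {a : ι} {s : Finset ι} (ha : a ∉ s) :
    (fun i => if i ∈ insert a s then g i else 1) = Pi.mulSingle a (g a) * fun i => if i ∈ s then g i else 1 := by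
  funext i
  by_cases hi : i = a
  · subst hi
    simp [ha]
  · simp [Finset.mem_insert, hi]

/-! ## §2  Factorwise action on pure tensors and product coefficients -/

/-- Truncated form of `rho_apply_tau`: `ρ (g|ₛ) (τ Φ) = τ (Φ with the coordinates in s acted on)`. [BorelJacquet1979, §4.1] -/
theorem rho_restrict_apply_tau {S : ι → Type*} {T : Type*} [AddCommMonoid T] [Module ℂ T] (τ : (Π i, S i) → T) (ρ : (Π i, G i) →* Module.End ℂ T)
    (op : ∀ i, G i → S i → S i) (hT : ∀ (i : ι) (g : G i) (Φ : Π i, S i), ρ (Pi.mulSingle i g) (τ Φ) = τ (Function.update Φ i (op i g (Φ i))))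
    (g : Π i, G i) (Φ : Π i, S i) (s : Finset ι) :
    ρ (fun i => if i ∈ s then g i else 1) (τ Φ) = τ (fun i => if i ∈ s then op i (g i) (Φ i) else Φ i) := by
  induction s using Finset.induction_on with
  | empty =>
    have h1 : (fun i => if i ∈ (∅ : Finset ι) then g i else 1) = (1 : Π i, G i) := restrict_empty g
    rw [h1, map_one, Module.End.one_apply]
    simp
  | @insert a s ha ih =>
    rw [restrict_insert g ha, map_mul, Module.End.mul_apply, ih, hT]
    congr 1
    funext i
    by_cases hi : i = a
    · subst hi
      simp [ha]
    · simp [Finset.mem_insert, hi]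

/-- **FACTORWISE ACTION ON PURE TENSORS**: under BINDER (T), `ρ g (τ Φ) = τ (i ↦ op i (g i) (Φ i))`. [BorelJacquet1979, §4.1] [Flath1979, §2] -/
theorem rho_apply_tau [Fintype ι] {S : ι → Type*} {T : Type*} [AddCommMonoid T] [Module ℂ T] (τ : (Π i, S i) → T) (ρ : (Π i, G i) →* Module.End ℂ T)
    (op : ∀ i, G i → S i → S i) (hT : ∀ (i : ι) (g : G i) (Φ : Π i, S i), ρ (Pi.mulSingle i g) (τ Φ) = τ (Function.update Φ i (op i g (Φ i))))
    (g : Π i, G i) (Φ : Π i, S i) : ρ g (τ Φ) = τ (fun i => op i (g i) (Φ i)) := by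
  have h := rho_restrict_apply_tau τ ρ op hT g Φ Finset.univ
  rw [restrict_univ] at h
  rw [h]
  simp

/-- **(⊗-3) THE COEFFICIENT OF A PURE TENSOR IS THE PRODUCT OF THE ONE-FACTOR COEFFICIENTS**: under (T) and (E), `ev (ρ g (τ Φ)) = ∏ i, evi i (op i (g i) (Φ i))`.
[BorelJacquet1979, §4.1] [Flath1979, §2] -/
theorem ev_rho_apply_tau [Fintype ι] {S : ι → Type*} {T : Type*} [AddCommMonoid T] [Module ℂ T] (τ : (Π i, S i) → T) (ρ : (Π i, G i) →* Module.End ℂ T)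
    (op : ∀ i, G i → S i → S i) (hT : ∀ (i : ι) (g : G i) (Φ : Π i, S i), ρ (Pi.mulSingle i g) (τ Φ) = τ (Function.update Φ i (op i g (Φ i))))
    (ev : T → ℂ) (evi : ∀ i, S i → ℂ) (hE : ∀ Φ : Π i, S i, ev (τ Φ) = ∏ i, evi i (Φ i)) (g : Π i, G i) (Φ : Π i, S i) :
    ev (ρ g (τ Φ)) = ∏ i, evi i (op i (g i) (Φ i)) := by
  rw [rho_apply_tau τ ρ op hT, hE]

/-! ## §3  (⊗-4): a finite sum of products of one-factor coefficients is one coefficient -/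

/-- **(⊗-4) REALISING A SUM OF PRODUCTS BY ONE VECTOR**: if `A g = Σ_r c_r ∏_i b_{r,i}(g i)` and every `b_{r,i}` is a one-factor coefficient `b_{r,i} u = evi i (op i u (Ψ r i))`,
then `A g = ev (ρ g v)` with `v = Σ_r c_r • τ (Ψ r)` (for a LINEAR `ev`). [BorelJacquet1979, §4.1] [GanQiuTakeda2014, §5.6] -/
theorem exists_vector_of_sum_prod [Fintype ι] {S : ι → Type*} {T : Type*} [AddCommMonoid T] [Module ℂ T] (τ : (Π i, S i) → T) (ρ : (Π i, G i) →* Module.End ℂ T)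
    (op : ∀ i, G i → S i → S i) (hT : ∀ (i : ι) (g : G i) (Φ : Π i, S i), ρ (Pi.mulSingle i g) (τ Φ) = τ (Function.update Φ i (op i g (Φ i))))
    (ev : T →ₗ[ℂ] ℂ) (evi : ∀ i, S i → ℂ) (hE : ∀ Φ : Π i, S i, ev (τ Φ) = ∏ i, evi i (Φ i))
    {m : ℕ} (c : Fin m → ℂ) (b : Fin m → ∀ i, (G i → ℂ)) (Ψ : Fin m → Π i, S i) (hb : ∀ r i (u : G i), b r i u = evi i (op i u (Ψ r i)))
    {A : (Π i, G i) → ℂ} (hA : ∀ g, A g = ∑ r, c r * ∏ i, b r i (g i)) :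
    ∃ v : T, (v = ∑ r, c r • τ (Ψ r)) ∧ ∀ g, A g = ev (ρ g v) := by
  refine ⟨∑ r, c r • τ (Ψ r), rfl, fun g => ?_⟩
  rw [hA g, map_sum, map_sum]
  refine Finset.sum_congr rfl fun r _ => ?_
  rw [map_smul, map_smul, smul_eq_mul, ev_rho_apply_tau τ ρ op hT ev evi hE]
  congr 1
  exact Finset.prod_congr rfl fun i _ => hb r i (g i)

/-- **THE SAME WITH A FUNCTION-VALUED `ev`** (no linearity packaged): pure-tensor version only — `A` realised TERMWISE: `A g = Σ_r c_r · ev (ρ g (τ (Ψ r)))`.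
[BorelJacquet1979, §4.1] -/
theorem sum_prod_eq_sum_ev [Fintype ι] {S : ι → Type*} {T : Type*} [AddCommMonoid T] [Module ℂ T] (τ : (Π i, S i) → T) (ρ : (Π i, G i) →* Module.End ℂ T)
    (op : ∀ i, G i → S i → S i) (hT : ∀ (i : ι) (g : G i) (Φ : Π i, S i), ρ (Pi.mulSingle i g) (τ Φ) = τ (Function.update Φ i (op i g (Φ i))))
    (ev : T → ℂ) (evi : ∀ i, S i → ℂ) (hE : ∀ Φ : Π i, S i, ev (τ Φ) = ∏ i, evi i (Φ i))
    {m : ℕ} (c : Fin m → ℂ) (b : Fin m → ∀ i, (G i → ℂ)) (Ψ : Fin m → Π i, S i) (hb : ∀ r i (u : G i), b r i u = evi i (op i u (Ψ r i))) (g : Π i, G i) :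
    ∑ r, c r * ∏ i, b r i (g i) = ∑ r, c r * ev (ρ g (τ (Ψ r))) := by
  refine Finset.sum_congr rfl fun r _ => ?_
  rw [ev_rho_apply_tau τ ρ op hT ev evi hE]
  congr 1
  exact Finset.prod_congr rfl fun i _ => hb r i (g i)

end Summit.HodgeConjecture.HodgeConjecture.Cruxes.HLiu418.K2LiuPureTensorFactorwiseFunctional
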